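import Literature.NumberTheory.Automorphic.SupercuspTypeCuspidalImage
import Literature.NumberTheory.Automorphic.GLnCuspidalHilbertSchmidt
import Literature.NumberTheory.Automorphic.GLnCuspidalSpectrumProofs
import Literature.NumberTheory.Automorphic.AutomorphicQuotientKernelDiagonal
import Literature.NumberTheory.Automorphic.AdelicGroupDataQuotientUnimodular
import Literature.NumberTheory.Automorphic.GLnIwasawaIntegration
import Literature.NumberTheory.Automorphic.AutomorphicL2Separable
import HarnessLib

/-!
# `tr R₀(Φ ⋆ Φ^*) = c⁻¹ ∫_X K_{Φ ⋆ Φ^*}(x, x) dx < ∞` for supercusp-type test functions on `GL_n`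
(Gelbart, *Automorphic forms on adele groups* (1975), (10.13) and (9.11) for the `GL₂` side of
(10.15); Jacquet–Langlands (1970), §16, p. 503; Arthur–Clozel (1989), Ch. 1, Lemma 2.4)

Topic `NumberTheory/Automorphic`; theorems only (no definition, no named fact, no instance
visible to importers — the two invariances of `quotientSubgroupHaar` are local instances). A brick
of the inline (D-0026) decomposition of
`Literature.NumberTheory.Automorphic.jacquetLanglands_transfer_exists` (Gelbart Thm. 10.5 (i)):
the **spectral-to-geometric hinge of the `GL₂` trace formula for the special test functions of the
comparison**, assembled from four bricks of the tree —

* `SupercuspTypeCuspidalImage`: for `η ∈ C_c(GL_n(𝔸_K))` with vanishing unipotent averages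
  `(H_k)` (all `0 < k < n`), `R(η)` maps `L²(X)` into `L²_cusp` and kills `L²_cuspᗮ`;
* `GLnCuspidalHilbertSchmidt`: `R(Φ)|_{L²_cusp}` is Hilbert–Schmidt for a (complex) test function
  `Φ = η₁ + i η₂` (Gelbart Prop. 9.6);
* `AutomorphicQuotientKernelNoncompact` / `AutomorphicQuotientKernelDiagonal`: on the non-compact
  quotient `X = GL_n(𝔸_K) ⧸ A_G GL_n(K)`, `Σ_i ‖R(f) e_i‖² = c⁻¹ ∫_X re K_{f ⋆ f^*}(x, x) dμ` in
  `[0, ∞]` (Gelbart (9.11), (9.20));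

into the statement that, for a supercusp-type test function `Φ` on `GL_n(𝔸_K)`,

  `Σ_j ‖R(Φ) e_j‖²  (Hilbert basis of L²_cusp)  =  Σ_l ‖R(Φ) e_l‖²  (Hilbert basis of L²(X))`
  `= c⁻¹ ∫_X K_{Φ ⋆ Φ^*}(x, x) dμ(x)  < ∞`,

the diagonal `x ↦ K_{Φ ⋆ Φ^*}(x, x)` being a non-negative **integrable** continuous function on `X`
(`tsum_enorm_sq_integratedOperator_cuspidal_eq_ofReal_integral_diagonal`,
`integrable_re_quotientKernel_mulConv_mulStar_diagonal`). This is Gelbart's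
`tr R₀^ψ(Φ_f) = tr τ(f ⋆ f^*)` ((10.13)) followed by `tr R₀(Φ) = ∫ K_Φ(x, x) dx` — for these `Φ`
with **no Eisenstein series and no truncation on the spectral side**: the kernel of `R(Φ)` is
already cuspidal (Jacquet–Langlands p. 503, Arthur–Clozel Lemma 2.4), so the full kernel over the
diagonal computes the cuspidal trace, and the integral converges absolutely because `R₀(Φ)` is
Hilbert–Schmidt. What remains of (10.15) after this file is purely geometric: the evaluation of
`∫_X K_{Φ ⋆ Φ^*}(x, x) dμ(x)` by conjugacy classes.

* `tsum_enorm_sq_apply_eq_of_apply_orthogonal_eq_zero` (abstract) — the Hilbert–Schmidt sum over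
  `H` of an operator killing `Mᗮ` is its Hilbert–Schmidt sum over `M`.
* `GLnCuspidalSpectrum.tsum_enorm_sq_integratedOperator_eq_tsum_cuspidal` — for `η` with `(H_k)`:
  `Σ'_l ‖R(η) e_l‖ₑ² (basis of L²) = Σ'_j ‖R(η) e_j‖ₑ² (basis of L²_cusp)`.
* `GLnCuspidalSpectrum.tsum_enorm_sq_integratedOperator_lt_top_of_supercuspType` — finiteness for
  `Φ = η₁ + i η₂`, `η₁, η₂` test functions, with `(H_k)`.
* `GLnCuspidalSpectrum.lintegral_re_quotientKernel_diagonal_lt_top`,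
  `integrable_re_quotientKernel_mulConv_mulStar_diagonal`,
  `tsum_enorm_sq_integratedOperator_cuspidal_eq_ofReal_integral_diagonal` — the hinge.

Conventions: `ν = adelicHaar n K` (a Haar measure of `GL_n(𝔸_K)`, inversion invariant by
unimodularity, `adelicHaar_isInvInvariant`); `ρ_H = quotientSubgroupHaar n K` on
`H = A_G · GL_n(K)` (two-sided and inversion invariant: `isMulRightInvariant_quotientSubgroup_gl`,
`isInvInvariant_of_isMulRightInvariant`); `c = automorphicUnfoldingConstant n K μ ν`.

## References

* S. Gelbart, *Automorphic forms on adele groups*, Ann. of Math. Studies 83 (1975), (9.11), Prop. 9.6,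
  (10.13)–(10.15) [Gelbart1975].
* H. Jacquet, R. P. Langlands, *Automorphic forms on `GL(2)`*, LNM 114 (1970), §16, p. 503
  [JacquetLanglands1970].
* J. Arthur, L. Clozel, *Simple algebras, base change, and the advanced theory of the trace formula*
  (1989), Ch. 1, Lemma 2.4 [ArthurClozel1989].
-/

noncomputable section

open MeasureTheory Measure Set Filter Topology CompactlySupported NumberField IsDedekindDomain
open Literature.MeasureTheory.Group
open scoped ENNReal NNReal InnerProductSpace ComplexConjugate

namespace Literature.NumberTheory.Automorphic

-- the coset spaces carry Borel σ-algebras supplied locally, not the quotient σ-algebra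
attribute [-instance] Quotient.instMeasurableSpace QuotientGroup.measurableSpace

/-! ### Abstract: an operator killing `Mᗮ` has the same Hilbert–Schmidt sum over `H` and over `M` -/

section Abstract

variable {H F : Type*} [NormedAddCommGroup H] [InnerProductSpace ℂ H] [CompleteSpace H]
  [NormedAddCommGroup F] [InnerProductSpace ℂ F] [CompleteSpace F]

/-- **The Hilbert–Schmidt sum over `H` of an operator killing `Mᗮ` equals its Hilbert–Schmidt sum
over `M`**: for a closed subspace `M`, a bounded `A : H → F` with `A x = 0` for `x ∈ Mᗮ`, and
Hilbert bases `(e_l)` of `H`, `(e'_j)` of `M`, `Σ'_l ‖A e_l‖ₑ² = Σ'_j ‖A e'_j‖ₑ²`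
(`tsum_nnnorm_sq_apply_eq_of_le_of_apply_eq_zero` of `JacquetLanglandsExistsOfTraceComparison`
with `E = ⊤`, the basis of `H` transported to `⊤`). This is "`tr R(Φ) = tr R₀(Φ)`" for an `R(Φ)`
vanishing on the orthogonal complement of the cusp forms (Gelbart (1975), (10.13)).
[cite: Gelbart1975, (10.13)] -/
theorem tsum_enorm_sq_apply_eq_of_apply_orthogonal_eq_zero (M : Submodule ℂ H) [CompleteSpace M]
    (A : H →L[ℂ] F) (hA : ∀ x ∈ Mᗮ, A x = 0) {ι₀ ι : Type*} (B₀ : HilbertBasis ι₀ ℂ H)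
    (b : HilbertBasis ι ℂ M) :
    ∑' l, ‖A (B₀ l)‖ₑ ^ 2 = ∑' j, ‖A (b j)‖ₑ ^ 2 := by
  obtain ⟨w, c, -⟩ := exists_hilbertBasis ℂ F
  have h1 := Literature.Analysis.OperatorTheory.tsum_enorm_sq_apply_eq_tsum_enorm_sq_adjoint_apply
    B₀ c A
  have h2 := Literature.Analysis.OperatorTheory.tsum_enorm_sq_apply_eq_tsum_enorm_sq_adjoint_apply
    b c (A ∘L M.subtypeL)
  have h2' : ∑' j, ‖A (b j)‖ₑ ^ 2 = ∑' j, ‖(A ∘L M.subtypeL) (b j)‖ₑ ^ 2 :=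
    tsum_congr fun j => rfl
  rw [h1, h2', h2]
  refine tsum_congr fun k => ?_
  -- `A† c_k ∈ M` (it is orthogonal to `Mᗮ`, on which `A` vanishes)
  have hmem : ContinuousLinearMap.adjoint A (c k) ∈ M := by
    rw [← Submodule.orthogonal_orthogonal M, Submodule.mem_orthogonal]
    intro m hm
    rw [ContinuousLinearMap.adjoint_inner_right, hA m hm, inner_zero_left]
  -- so its projection to `M` has the same norm
  have hP : ((M.orthogonalProjectionOnto (ContinuousLinearMap.adjoint A (c k)) : M) : H) =
      ContinuousLinearMap.adjoint A (c k) := by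
    rw [Submodule.coe_orthogonalProjectionOnto_apply]
    exact Submodule.starProjection_eq_self_iff.2 hmem
  rw [ContinuousLinearMap.adjoint_comp, Submodule.adjoint_subtypeL, ContinuousLinearMap.comp_apply]
  change _ = ‖((M.orthogonalProjectionOnto (ContinuousLinearMap.adjoint A (c k)) : M) : H)‖ₑ ^ 2
  rw [hP]

end Abstract

/-! ### `GL_n`: the Hilbert–Schmidt sum of `R(η)` over `L²` is its sum over `L²_cusp` -/

section GLn

variable {n : ℕ} {K : Type} [Field K] [NumberField K]
  {μ : Measure (AdelicGroupData.gl n K).automorphicQuotient}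
  [(AdelicGroupData.gl n K).IsAutomorphicMeasure μ]

attribute [local instance] adelicBorel borelSpace_adelic locallyCompactSpace_adelic
  secondCountableTopology_gl_adelic

/-- **`Σ'_l ‖R(η) e_l‖ₑ² over `L²(X)` equals `Σ'_j ‖R(η) e_j‖ₑ²` over `L²_cusp`** for
`η ∈ C_c(GL_n(𝔸_K))` with vanishing unipotent averages `(H_k)` (`0 < k < n`) and an
inversion-invariant Haar measure `ν`: `R(η)` kills `L²_cuspᗮ`
(`integratedOperator_rightRegular_eq_zero_of_mem_orthogonal`, `SupercuspTypeCuspidalImage`), and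
`tsum_enorm_sq_apply_eq_of_apply_orthogonal_eq_zero` applies. This is Gelbart's (10.13),
`tr R₀^ψ(Φ) = tr τ(f ⋆ f^*)`, in the form "the trace of `R(Φ)` on all of `L²` is its trace on the
cusp forms" (Jacquet–Langlands (1970), p. 503). [cite: Gelbart1975, (10.13)] -/
theorem GLnCuspidalSpectrum.tsum_enorm_sq_integratedOperator_eq_tsum_cuspidal
    {η : C_c((AdelicGroupData.gl n K).Adelic, ℂ)}
    (hη0 : ∀ k, 0 < k → k < n →
      ∀ (ν𝔫 : Measure (blockNilpotent n k (AdeleRing (𝓞 K) K))) [ν𝔫.IsAddHaarMeasure]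
        (p r : (AdelicGroupData.gl n K).Adelic),
        ∫ Y, η (p * glUnipotent n k K (Multiplicative.ofAdd Y) * r) ∂ν𝔫 = 0)
    (ν : Measure (AdelicGroupData.gl n K).Adelic) [ν.IsHaarMeasure] [ν.IsInvInvariant]
    {ι₀ ι : Type*} (B₀ : HilbertBasis ι₀ ℂ ((AdelicGroupData.gl n K).L2 μ))
    (b : HilbertBasis ι ℂ (cuspidalSubspace n K μ).toSubmodule) :
    ∑' l, ‖((AdelicGroupData.gl n K).rightRegular μ).integratedOperator
        ((AdelicGroupData.gl n K).isUnitary_rightRegular μ)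
        ((AdelicGroupData.gl n K).isStronglyContinuous_rightRegular_holds μ) ν η (B₀ l)‖ₑ ^ 2 =
      ∑' j, ‖((AdelicGroupData.gl n K).rightRegular μ).integratedOperator
        ((AdelicGroupData.gl n K).isUnitary_rightRegular μ)
        ((AdelicGroupData.gl n K).isStronglyContinuous_rightRegular_holds μ) ν η
        (b j : (AdelicGroupData.gl n K).L2 μ)‖ₑ ^ 2 :=
  tsum_enorm_sq_apply_eq_of_apply_orthogonal_eq_zero (cuspidalSubspace n K μ).toSubmodule _
    (fun _ hx => integratedOperator_rightRegular_eq_zero_of_mem_orthogonal hη0 ν hx) B₀ b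

/-- **`R(Φ)` is Hilbert–Schmidt on all of `L²(GL_n(𝔸_K) ⧸ A_G GL_n(K))` for a supercusp-type
test function** `Φ = η₁ + i η₂` (`η₁, η₂` test functions, `IsTestFunctionGL`) with vanishing
unipotent averages `(H_k)`, `0 < k < n`: for every Hilbert basis `(e_l)` of `L²(X)`,
`Σ'_l ‖R(Φ) e_l‖ₑ² < ∞` — the sum over `L²` is the sum over `L²_cusp`
(`tsum_enorm_sq_integratedOperator_eq_tsum_cuspidal`), which is finite by Gelbart's Prop. 9.6
(`tsum_enorm_sq_integratedOperator_cuspidal_lt_top_of_re_im`, `GLnCuspidalHilbertSchmidt`). Here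
`ν = adelicHaar`. [cite: Gelbart1975, Prop. 9.6 and (10.13)] -/
theorem GLnCuspidalSpectrum.tsum_enorm_sq_integratedOperator_lt_top_of_supercuspType
    (Φ : C_c((AdelicGroupData.gl n K).Adelic, ℂ))
    {η₁ η₂ : (AdelicGroupData.gl n K).Adelic → ℝ} (hη₁ : IsTestFunctionGL n K η₁)
    (hη₂ : IsTestFunctionGL n K η₂) (hΦ : ∀ g, Φ g = η₁ g + η₂ g * Complex.I)
    (hΦ0 : ∀ k, 0 < k → k < n →
      ∀ (ν𝔫 : Measure (blockNilpotent n k (AdeleRing (𝓞 K) K))) [ν𝔫.IsAddHaarMeasure]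
        (p r : (AdelicGroupData.gl n K).Adelic),
        ∫ Y, Φ (p * glUnipotent n k K (Multiplicative.ofAdd Y) * r) ∂ν𝔫 = 0)
    {ι₀ : Type*} (B₀ : HilbertBasis ι₀ ℂ ((AdelicGroupData.gl n K).L2 μ)) :
    ∑' l, ‖((AdelicGroupData.gl n K).rightRegular μ).integratedOperator
        ((AdelicGroupData.gl n K).isUnitary_rightRegular μ)
        ((AdelicGroupData.gl n K).isStronglyContinuous_rightRegular_holds μ) (adelicHaar n K) Φ
        (B₀ l)‖ₑ ^ 2 < ∞ := by
  haveI : (adelicHaar n K).IsInvInvariant := adelicHaar_isInvInvariant n K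
  obtain ⟨w, b, -⟩ := exists_hilbertBasis ℂ (cuspidalSubspace n K μ).toSubmodule
  rw [GLnCuspidalSpectrum.tsum_enorm_sq_integratedOperator_eq_tsum_cuspidal hΦ0 (adelicHaar n K)
    B₀ b]
  exact GLnCuspidalSpectrum.tsum_enorm_sq_integratedOperator_cuspidal_lt_top_of_re_im Φ hη₁ hη₂ hΦ
    b.orthonormal

end GLn

/-! ### The hinge: `Σ_j ‖R(Φ) e_j‖² (cusp forms) = c⁻¹ ∫_X K_{Φ ⋆ Φ^*}(x, x) dμ < ∞` -/

section Hinge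

variable {n : ℕ} {K : Type} [Field K] [NumberField K]
  {μ : Measure (AdelicGroupData.gl n K).automorphicQuotient}
  [(AdelicGroupData.gl n K).IsAutomorphicMeasure μ]

attribute [local instance] adelicBorel borelSpace_adelic locallyCompactSpace_adelic
  secondCountableTopology_gl_adelic
  AdelicGroupData.measurableSpaceQuotientForm AdelicGroupData.borelSpaceQuotientForm
  AdelicGroupData.smulInvariantMeasureQuotientForm AdelicGroupData.isFiniteMeasureOnCompactsQuotientForm
  AdelicGroupData.isFiniteMeasureQuotientForm

variable (n K) in
/-- The Haar measure `ρ_H` of `H = A_G · GL_n(K)` is right invariant (unimodularity of `H`,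
`isMulRightInvariant_quotientSubgroup_gl`); a *local* instance below. [folklore] -/
theorem isMulRightInvariant_quotientSubgroupHaar : (quotientSubgroupHaar n K).IsMulRightInvariant :=
  AdelicGroupData.isMulRightInvariant_quotientSubgroup_gl n K (quotientSubgroupHaar n K)

attribute [local instance] isMulRightInvariant_quotientSubgroupHaar

variable (n K) in
/-- The Haar measure `ρ_H` of `H = A_G · GL_n(K)` is invariant under inversion (left and right
invariant Haar measure on a second countable locally compact group,
`isInvInvariant_of_isMulRightInvariant`); a *local* instance below. [folklore] -/
theorem isInvInvariant_quotientSubgroupHaar : (quotientSubgroupHaar n K).IsInvInvariant :=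
  isInvInvariant_of_isMulRightInvariant (quotientSubgroupHaar n K)

attribute [local instance] isInvInvariant_quotientSubgroupHaar

variable (μ) in
/-- **`Σ'_j ‖R(Φ) e_j‖ₑ² (basis of L²_cusp) = ofReal (c⁻¹) · ∫⁻_X re K_{Φ ⋆ Φ^*}(x, x) dμ`** for
`Φ ∈ C_c(GL_n(𝔸_K))` with vanishing unipotent averages `(H_k)` (`0 < k < n`): the sum over
`L²_cusp` is the sum over `L²` (`tsum_enorm_sq_integratedOperator_eq_tsum_cuspidal`), which is
Gelbart's (9.11) on the non-compact quotient
(`AdelicGroupData.tsum_enorm_sq_integratedOperator_rightRegular_eq_lintegral_diagonal` for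
`H = A_G · GL_n(K)` with its two-sided Haar measure `ρ_H = quotientSubgroupHaar`). Both sides in
`[0, ∞]`; `ν = adelicHaar`, `c = automorphicUnfoldingConstant n K μ (adelicHaar n K)`.
[cite: Gelbart1975, (9.11) and (10.13)] -/
theorem GLnCuspidalSpectrum.tsum_enorm_sq_integratedOperator_cuspidal_eq_lintegral_diagonal
    {Φ : C_c((AdelicGroupData.gl n K).Adelic, ℂ)}
    (hΦ0 : ∀ k, 0 < k → k < n →
      ∀ (ν𝔫 : Measure (blockNilpotent n k (AdeleRing (𝓞 K) K))) [ν𝔫.IsAddHaarMeasure]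
        (p r : (AdelicGroupData.gl n K).Adelic),
        ∫ Y, Φ (p * glUnipotent n k K (Multiplicative.ofAdd Y) * r) ∂ν𝔫 = 0)
    {ι : Type*} (b : HilbertBasis ι ℂ (cuspidalSubspace n K μ).toSubmodule) :
    ∑' j, ‖((AdelicGroupData.gl n K).rightRegular μ).integratedOperator
        ((AdelicGroupData.gl n K).isUnitary_rightRegular μ)
        ((AdelicGroupData.gl n K).isStronglyContinuous_rightRegular_holds μ) (adelicHaar n K) Φ
        (b j : (AdelicGroupData.gl n K).L2 μ)‖ₑ ^ 2 =
      ENNReal.ofReal ((automorphicUnfoldingConstant n K μ (adelicHaar n K) : ℝ)⁻¹) *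
        ∫⁻ x, ENNReal.ofReal ((quotientKernel (AdelicGroupData.gl n K).quotientSubgroup
          (quotientSubgroupHaar n K) (mulConv (adelicHaar n K) (Φ : _ → ℂ) (mulStar Φ)) x x).re) ∂μ := by
  haveI : (adelicHaar n K).IsInvInvariant := adelicHaar_isInvInvariant n K
  -- a Hilbert basis of `L²` with countable index (`L²` is separable, `AutomorphicL2Separable`)
  obtain ⟨w, B₀, hw, -⟩ := GLn.exists_countable_hilbertBasis_L2 n K μ
  haveI : Countable w := hw
  have hρ : quotientSubgroupHaar n K ≠ 0 := by
    intro h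
    have h2 : 0 < quotientSubgroupHaar n K Set.univ :=
      isOpen_univ.measure_pos (quotientSubgroupHaar n K) ⟨1, trivial⟩
    rw [h] at h2
    exact lt_irrefl _ h2
  rw [← GLnCuspidalSpectrum.tsum_enorm_sq_integratedOperator_eq_tsum_cuspidal hΦ0 (adelicHaar n K)
    B₀ b]
  exact AdelicGroupData.tsum_enorm_sq_integratedOperator_rightRegular_eq_lintegral_diagonal
    (AdelicGroupData.gl n K) μ (quotientSubgroupHaar n K) (adelicHaar n K) hρ Φ B₀

variable (μ) in
/-- **`∫⁻_X re K_{Φ ⋆ Φ^*}(x, x) dμ < ∞` for a supercusp-type test function** `Φ = η₁ + i η₂`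
(`η₁, η₂` test functions) with `(H_k)`: the Hilbert–Schmidt sum over `L²_cusp` is finite (Gelbart
Prop. 9.6) and `c > 0`. [cite: Gelbart1975, Prop. 9.6 and (9.11)] -/
theorem GLnCuspidalSpectrum.lintegral_re_quotientKernel_diagonal_lt_top
    (Φ : C_c((AdelicGroupData.gl n K).Adelic, ℂ))
    {η₁ η₂ : (AdelicGroupData.gl n K).Adelic → ℝ} (hη₁ : IsTestFunctionGL n K η₁)
    (hη₂ : IsTestFunctionGL n K η₂) (hΦ : ∀ g, Φ g = η₁ g + η₂ g * Complex.I)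
    (hΦ0 : ∀ k, 0 < k → k < n →
      ∀ (ν𝔫 : Measure (blockNilpotent n k (AdeleRing (𝓞 K) K))) [ν𝔫.IsAddHaarMeasure]
        (p r : (AdelicGroupData.gl n K).Adelic),
        ∫ Y, Φ (p * glUnipotent n k K (Multiplicative.ofAdd Y) * r) ∂ν𝔫 = 0) :
    ∫⁻ x, ENNReal.ofReal ((quotientKernel (AdelicGroupData.gl n K).quotientSubgroup
        (quotientSubgroupHaar n K) (mulConv (adelicHaar n K) (Φ : _ → ℂ) (mulStar Φ)) x x).re) ∂μ
      < ∞ := by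
  obtain ⟨w, b, -⟩ := exists_hilbertBasis ℂ (cuspidalSubspace n K μ).toSubmodule
  have hfin := GLnCuspidalSpectrum.tsum_enorm_sq_integratedOperator_cuspidal_lt_top_of_re_im
    (μ := μ) Φ hη₁ hη₂ hΦ b.orthonormal
  rw [GLnCuspidalSpectrum.tsum_enorm_sq_integratedOperator_cuspidal_eq_lintegral_diagonal μ hΦ0 b]
    at hfin
  have hc : 0 < ((automorphicUnfoldingConstant n K μ (adelicHaar n K) : ℝ)⁻¹) :=
    inv_pos.2 (NNReal.coe_pos.2 (automorphicUnfoldingConstant_pos n K μ (adelicHaar n K)))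
  have hc0 : ENNReal.ofReal ((automorphicUnfoldingConstant n K μ (adelicHaar n K) : ℝ)⁻¹) ≠ 0 :=
    (ENNReal.ofReal_pos.2 hc).ne'
  exact lt_top_iff_ne_top.2 fun htop => by
    rw [htop, ENNReal.mul_top hc0] at hfin
    exact lt_irrefl _ hfin

variable (μ) in
/-- **The diagonal of the kernel of `Φ ⋆ Φ^*` is integrable on the non-compact quotient** for a
supercusp-type test function `Φ = η₁ + i η₂` with `(H_k)`: `x ↦ re K_{Φ ⋆ Φ^*}(x, x)` is a
non-negative continuous function with `∫⁻ < ∞`. (The imaginary parts vanish,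
`quotientKernel_mulConv_mulStar_diag_eq`.) [cite: Gelbart1975, (9.11) and Prop. 9.6] -/
theorem GLnCuspidalSpectrum.integrable_re_quotientKernel_mulConv_mulStar_diagonal
    (Φ : C_c((AdelicGroupData.gl n K).Adelic, ℂ))
    {η₁ η₂ : (AdelicGroupData.gl n K).Adelic → ℝ} (hη₁ : IsTestFunctionGL n K η₁)
    (hη₂ : IsTestFunctionGL n K η₂) (hΦ : ∀ g, Φ g = η₁ g + η₂ g * Complex.I)
    (hΦ0 : ∀ k, 0 < k → k < n →
      ∀ (ν𝔫 : Measure (blockNilpotent n k (AdeleRing (𝓞 K) K))) [ν𝔫.IsAddHaarMeasure]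
        (p r : (AdelicGroupData.gl n K).Adelic),
        ∫ Y, Φ (p * glUnipotent n k K (Multiplicative.ofAdd Y) * r) ∂ν𝔫 = 0) :
    Integrable (fun x => (quotientKernel (AdelicGroupData.gl n K).quotientSubgroup
        (quotientSubgroupHaar n K) (mulConv (adelicHaar n K) (Φ : _ → ℂ) (mulStar Φ)) x x).re) μ := by
  haveI : (adelicHaar n K).IsInvInvariant := adelicHaar_isInvInvariant n K
  -- continuity and non-negativity of the diagonal
  have hfc : Continuous (mulConv (adelicHaar n K) (Φ : _ → ℂ) (mulStar Φ)) :=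
    continuous_mulConv (adelicHaar n K) Φ.continuous Φ.hasCompactSupport
      (continuous_mulStar Φ.continuous)
  have hfcs : HasCompactSupport (mulConv (adelicHaar n K) (Φ : _ → ℂ) (mulStar Φ)) :=
    hasCompactSupport_mulConv (adelicHaar n K) Φ.hasCompactSupport
      (hasCompactSupport_mulStar Φ.hasCompactSupport)
  have hcont : Continuous fun x : (AdelicGroupData.gl n K).automorphicQuotient =>
      (quotientKernel (AdelicGroupData.gl n K).quotientSubgroup (quotientSubgroupHaar n K)
        (mulConv (adelicHaar n K) (Φ : _ → ℂ) (mulStar Φ)) x x).re := by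
    have h := continuous_uncurry_quotientKernel (AdelicGroupData.gl n K).quotientSubgroup
      (quotientSubgroupHaar n K) hfc hfcs
    exact Complex.continuous_re.comp (h.comp (continuous_id.prodMk continuous_id))
  have hc : unfoldingConstant (AdelicGroupData.gl n K).quotientSubgroup (quotientSubgroupHaar n K)
      μ (adelicHaar n K) ≠ 0 := (automorphicUnfoldingConstant_pos n K μ (adelicHaar n K)).ne'
  have hnn : ∀ x : (AdelicGroupData.gl n K).automorphicQuotient,
      0 ≤ (quotientKernel (AdelicGroupData.gl n K).quotientSubgroup (quotientSubgroupHaar n K)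
        (mulConv (adelicHaar n K) (Φ : _ → ℂ) (mulStar Φ)) x x).re := by
    intro x
    have h := re_quotientKernel_mulConv_mulStar_diag_eq (AdelicGroupData.gl n K).quotientSubgroup
      (quotientSubgroupHaar n K) μ (adelicHaar n K) (𝕜 := ℂ) hc (f := (Φ : _ → ℂ)) Φ.continuous
      Φ.hasCompactSupport x
    rw [show (quotientKernel (AdelicGroupData.gl n K).quotientSubgroup (quotientSubgroupHaar n K)
        (mulConv (adelicHaar n K) (Φ : _ → ℂ) (mulStar Φ)) x x).re = RCLike.re (quotientKernel
        (AdelicGroupData.gl n K).quotientSubgroup (quotientSubgroupHaar n K)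
        (mulConv (adelicHaar n K) (Φ : _ → ℂ) (mulStar Φ)) x x) from rfl, h]
    exact mul_nonneg (inv_nonneg.2 (NNReal.coe_nonneg _)) (integral_nonneg fun y => sq_nonneg _)
  refine ⟨hcont.aestronglyMeasurable, ?_⟩
  have hlt := GLnCuspidalSpectrum.lintegral_re_quotientKernel_diagonal_lt_top μ Φ hη₁ hη₂ hΦ hΦ0
  rw [hasFiniteIntegral_iff_enorm]
  refine lt_of_le_of_lt (le_of_eq (lintegral_congr fun x => ?_)) hlt
  rw [Real.enorm_eq_ofReal (hnn x)]

variable (μ) in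
/-- **The hinge of the `GL_n` trace formula for supercusp-type test functions** (Gelbart (1975),
(10.13) with (9.11); Jacquet–Langlands (1970), p. 503): for `Φ = η₁ + i η₂` (`η₁, η₂` test
functions) with vanishing unipotent averages `(H_k)`, `0 < k < n`, and every Hilbert basis `(e_j)`
of `L²_cusp(GL_n(𝔸_K) ⧸ A_G GL_n(K))`,

  `Σ'_j ‖R(Φ) e_j‖ₑ² = ofReal ( c⁻¹ ∫_X re K_{Φ ⋆ Φ^*}(x, x) dμ(x) )`,

a finite quantity: the cuspidal Hilbert–Schmidt norm (`tr R₀(Φ ⋆ Φ^*)`) is the absolutely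
convergent integral of the full kernel of `Φ ⋆ Φ^*` over the diagonal of the non-compact quotient.
[cite: Gelbart1975, (9.11) and (10.13)] -/
theorem GLnCuspidalSpectrum.tsum_enorm_sq_integratedOperator_cuspidal_eq_ofReal_integral_diagonal
    (Φ : C_c((AdelicGroupData.gl n K).Adelic, ℂ))
    {η₁ η₂ : (AdelicGroupData.gl n K).Adelic → ℝ} (hη₁ : IsTestFunctionGL n K η₁)
    (hη₂ : IsTestFunctionGL n K η₂) (hΦ : ∀ g, Φ g = η₁ g + η₂ g * Complex.I)
    (hΦ0 : ∀ k, 0 < k → k < n →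
      ∀ (ν𝔫 : Measure (blockNilpotent n k (AdeleRing (𝓞 K) K))) [ν𝔫.IsAddHaarMeasure]
        (p r : (AdelicGroupData.gl n K).Adelic),
        ∫ Y, Φ (p * glUnipotent n k K (Multiplicative.ofAdd Y) * r) ∂ν𝔫 = 0)
    {ι : Type*} (b : HilbertBasis ι ℂ (cuspidalSubspace n K μ).toSubmodule) :
    ∑' j, ‖((AdelicGroupData.gl n K).rightRegular μ).integratedOperator
        ((AdelicGroupData.gl n K).isUnitary_rightRegular μ)
        ((AdelicGroupData.gl n K).isStronglyContinuous_rightRegular_holds μ) (adelicHaar n K) Φ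
        (b j : (AdelicGroupData.gl n K).L2 μ)‖ₑ ^ 2 =
      ENNReal.ofReal (((automorphicUnfoldingConstant n K μ (adelicHaar n K) : ℝ)⁻¹) *
        ∫ x, (quotientKernel (AdelicGroupData.gl n K).quotientSubgroup (quotientSubgroupHaar n K)
          (mulConv (adelicHaar n K) (Φ : _ → ℂ) (mulStar Φ)) x x).re ∂μ) := by
  have hint := GLnCuspidalSpectrum.integrable_re_quotientKernel_mulConv_mulStar_diagonal μ Φ
    hη₁ hη₂ hΦ hΦ0
  haveI : (adelicHaar n K).IsInvInvariant := adelicHaar_isInvInvariant n K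
  have hc : unfoldingConstant (AdelicGroupData.gl n K).quotientSubgroup (quotientSubgroupHaar n K)
      μ (adelicHaar n K) ≠ 0 := (automorphicUnfoldingConstant_pos n K μ (adelicHaar n K)).ne'
  have hnn : ∀ x : (AdelicGroupData.gl n K).automorphicQuotient,
      0 ≤ (quotientKernel (AdelicGroupData.gl n K).quotientSubgroup (quotientSubgroupHaar n K)
        (mulConv (adelicHaar n K) (Φ : _ → ℂ) (mulStar Φ)) x x).re := by
    intro x
    have h := re_quotientKernel_mulConv_mulStar_diag_eq (AdelicGroupData.gl n K).quotientSubgroup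
      (quotientSubgroupHaar n K) μ (adelicHaar n K) (𝕜 := ℂ) hc (f := (Φ : _ → ℂ)) Φ.continuous
      Φ.hasCompactSupport x
    rw [show (quotientKernel (AdelicGroupData.gl n K).quotientSubgroup (quotientSubgroupHaar n K)
        (mulConv (adelicHaar n K) (Φ : _ → ℂ) (mulStar Φ)) x x).re = RCLike.re (quotientKernel
        (AdelicGroupData.gl n K).quotientSubgroup (quotientSubgroupHaar n K)
        (mulConv (adelicHaar n K) (Φ : _ → ℂ) (mulStar Φ)) x x) from rfl, h]
    exact mul_nonneg (inv_nonneg.2 (NNReal.coe_nonneg _)) (integral_nonneg fun y => sq_nonneg _)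
  have h3 : ∫⁻ x, ENNReal.ofReal ((quotientKernel (AdelicGroupData.gl n K).quotientSubgroup
      (quotientSubgroupHaar n K) (mulConv (adelicHaar n K) (Φ : _ → ℂ) (mulStar Φ)) x x).re) ∂μ =
      ENNReal.ofReal (∫ x, (quotientKernel (AdelicGroupData.gl n K).quotientSubgroup
        (quotientSubgroupHaar n K) (mulConv (adelicHaar n K) (Φ : _ → ℂ) (mulStar Φ)) x x).re ∂μ) :=
    (ofReal_integral_eq_lintegral_ofReal hint (Eventually.of_forall hnn)).symm
  rw [GLnCuspidalSpectrum.tsum_enorm_sq_integratedOperator_cuspidal_eq_lintegral_diagonal μ hΦ0 b,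
    h3, ENNReal.ofReal_mul (inv_nonneg.2 (NNReal.coe_nonneg _))]

end Hinge

end Literature.NumberTheory.Automorphic
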